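import Summits.ABC.ABC.Theorems.IneffectiveSubspaceDepthCountedABCStubCellOneCases
import Literature.NumberTheory.DiophantineApproximation.RidoutIntegers

/-!
# Stub `stub_cellOneLittleO` of line `Sketch` — crux `DepthCountedABC` (stmt-ABC-14938)

WHAT.  On the cell `#{p : v_p(abc) ≥ 5} ≤ 1` (at most one prime has exponent `≥ 5` in `abc`) the
free bound is `c < 2·rad(abc)⁴` (`stub_calibration`); this certificate records what Ridout's `p`-adic
Thue–Siegel–Roth theorem (PROVED in the tree, packaged as the Bugeaud–Evertse–Győry `S`-part bound
`[f(x)]_S ≪ |f(x)|^{1/n+ε}`) gives unconditionally one step further: `c = o(rad(abc)⁴)` on the cell,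
i.e. for every `κ > 0` there is `c₀` such that every abc triple of the cell with `c ≥ c₀` has
`c < κ·rad(abc)⁴`.

MECHANISM.  By `stub_cellOneCases`, an abc triple of the cell ordered `a ≤ b` either has
`c < 2·rad²`, or is a binomial quartic Thue–Mahler datum `a + p^k·u = v·Z⁴ = c` with
`a·u·v·p·c⁴ ≤ rad¹⁶`, or a datum `a + u·Y⁴ = p^w·v = c` with `c ≤ 2b`, `b = uY⁴`, `a·u·v·p·b⁴ ≤ rad¹⁶`.
If `κ·rad⁴ ≤ c`, the first case forces `c < 4/κ`, and in the other two `a·u·v·p ≤ 16/κ⁴ =: N` is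
bounded, so the datum `(a, ·, p)` ranges over a finite box.  On each fibre the `S`-part theorem with
`f = X⁴ ∓ m`, `S = {p}`, `ε = 1/4` gives `p^k ≤ C·|n|` whenever `x⁴ − m = p^k·n`
(`cellOneLittleO_quartic_sPart`); at `x = vZ` (resp. `x = uY`) this bounds the prime power `p^k`
(resp. `p^w`) linearly in the cofactor, hence `c` by a constant depending on the fibre; the maximum of
these constants over the box (`cellOneLittleO_box_left/right`, the `Finset.sup` pattern of
`fibreRoth_box`) bounds `c` below some `c₀ = c₀(κ)`.  (Ineffective: the constants come from Roth.)

Sources: skeleton `Cruxes/DepthCountedABC/Lines/Sketch.lean` (lead c23), stub `stub_cellOneLittleO`.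
Ingredients: `Summit.ABC.ABC.Theorems.DepthCountedABC.stub_cellOneCases`
(`Theorems/IneffectiveSubspaceDepthCountedABCStubCellOneCases.lean`),
`Literature.NumberTheory.DiophantineApproximation.BugeaudEvertseGyory2018_SPartPolynomialValues_holds`
(`Literature/NumberTheory/DiophantineApproximation/RidoutIntegers.lean`; Bugeaud–Evertse–Győry 2018
Thm. 2.1 (i), PROVED in the tree after Ridout), `Literature.NumberTheory.DiophantineApproximation.sPart`,
`Literature.NumberTheory.DiophantineGeometry.rad_def`, and Mathlib (`Polynomial.separable_X_pow_sub_C`,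
`Polynomial.natDegree_X_pow_sub_C`, `padicValInt_dvd_iff_of_ne_one`, `Real.sqrt_eq_rpow`,
`Real.sq_sqrt`, `Finset.le_sup`, `exists_nat_ge`, `exists_nat_gt`).  No unproved facts.
Deliberately NOT here: any power saving `rad^(4−δ)` on the cell (equivalent to a UNIFORM quartic
Thue–Mahler statement, open) and the 5-free cell (`stub_cellZeroLittleO`).
-/

-- `Summit.<Summit>.<Problem>` is the mandated summit-side namespace (CONVENTIONS §2); for the
-- single-conjunct summit `ABC` the two coincide, so the duplicate `ABC.ABC` is deliberate.
set_option linter.dupNamespace false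

namespace Summit.ABC.ABC.Theorems.DepthCountedABC

open Literature.NumberTheory.DiophantineApproximation in
/-- **The `p`-part of `x⁴ − m` is at most the square root of its value, up to a constant.**  For a
prime `p` and a non-zero integer `m` there is `C = C(p, m) > 0` such that `p^k ≤ C·|n|` whenever
`x⁴ − m = p^k·n` with `n ≠ 0`: the `S`-part theorem of Bugeaud–Evertse–Győry (Thm. 2.1 (i), from
Ridout's theorem) for `f = X⁴ − m`, `S = {p}`, `ε = 1/4` gives `p^k ≤ [f(x)]_{p} ≤ C₀·|p^k n|^{1/2}`,
whence `p^k ≤ C₀²·|n|`. [cite: BugeaudEvertseGyory2018, Thm. 2.1 (i)] -/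
theorem cellOneLittleO_quartic_sPart {p : ℕ} (hp : p.Prime) {m : ℤ} (hm : m ≠ 0) :
    ∃ C : ℝ, 0 < C ∧ ∀ (x n : ℤ) (k : ℕ), n ≠ 0 → x ^ 4 - m = (p : ℤ) ^ k * n →
      (p : ℝ) ^ k ≤ C * |(n : ℝ)| := by
  have hdeg : (Polynomial.X ^ 4 - Polynomial.C m : Polynomial ℤ).natDegree = 4 :=
    Polynomial.natDegree_X_pow_sub_C
  have hsep : ((Polynomial.X ^ 4 - Polynomial.C m : Polynomial ℤ).map (Int.castRingHom ℚ)).Separable := by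
    rw [Polynomial.map_sub, Polynomial.map_pow, Polynomial.map_X, Polynomial.map_C]
    exact Polynomial.separable_X_pow_sub_C _ (by norm_num) (by simpa using hm)
  obtain ⟨C₀, hC₀, hbd⟩ := BugeaudEvertseGyory2018_SPartPolynomialValues_holds
    (Polynomial.X ^ 4 - Polynomial.C m) (by rw [hdeg]; norm_num) hsep {p} (by simpa using hp)
    (Finset.singleton_nonempty p) (1 / 4) (by norm_num)
  refine ⟨C₀ ^ 2, by positivity, ?_⟩
  intro x n k hn hx
  have hp0 : (p : ℤ) ≠ 0 := by exact_mod_cast hp.ne_zero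
  have heval : (Polynomial.X ^ 4 - Polynomial.C m : Polynomial ℤ).eval x = (p : ℤ) ^ k * n := by
    rw [Polynomial.eval_sub, Polynomial.eval_pow, Polynomial.eval_X, Polynomial.eval_C, hx]
  have hne : (Polynomial.X ^ 4 - Polynomial.C m : Polynomial ℤ).eval x ≠ 0 := by
    rw [heval]; exact mul_ne_zero (pow_ne_zero _ hp0) hn
  -- `p^k ≤ [f(x)]_{p}`
  have hk : k ≤ padicValInt p ((Polynomial.X ^ 4 - Polynomial.C m : Polynomial ℤ).eval x) := by
    have hdvd : (p : ℤ) ^ k ∣ (Polynomial.X ^ 4 - Polynomial.C m : Polynomial ℤ).eval x := by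
      rw [heval]; exact dvd_mul_right _ _
    rcases (padicValInt_dvd_iff_of_ne_one hp.ne_one k _).mp hdvd with h | h
    · exact absurd h hne
    · exact h
  have hsPart : (p : ℝ) ^ k ≤
      (sPart {p} ((Polynomial.X ^ 4 - Polynomial.C m : Polynomial ℤ).eval x) : ℝ) := by
    rw [sPart, Finset.prod_singleton, Nat.cast_pow]
    exact pow_le_pow_right₀ (by exact_mod_cast hp.one_lt.le) hk
  -- the `S`-part bound at `x`, exponent `1/4 + 1/4 = 1/2`
  have hppos : 0 < p := hp.pos
  set y : ℝ := (p : ℝ) ^ k with hy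
  set t : ℝ := |(n : ℝ)| with ht
  have hypos : 0 < y := by positivity
  have hyt : 0 ≤ y * t := by positivity
  have habs : |(((Polynomial.X ^ 4 - Polynomial.C m : Polynomial ℤ).eval x : ℤ) : ℝ)| = y * t := by
    rw [heval, hy, ht]
    push_cast
    rw [abs_mul, abs_pow, Nat.abs_cast]
  have hexp : (1 : ℝ) / ((4 : ℕ) : ℝ) + 1 / 4 = 1 / 2 := by norm_num
  have h1 : y ≤ C₀ * (y * t) ^ ((1 : ℝ) / 2) := by
    have h := hbd x hne
    rw [hdeg, habs, hexp] at h
    exact hsPart.trans h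
  -- square and divide by `y > 0`
  have h2 : y ^ 2 ≤ C₀ ^ 2 * (y * t) := by
    have := pow_le_pow_left₀ hypos.le h1 2
    rwa [mul_pow, ← Real.sqrt_eq_rpow, Real.sq_sqrt hyt] at this
  have h3 : y * y ≤ C₀ ^ 2 * t * y :=
    calc y * y = y ^ 2 := (sq y).symm
      _ ≤ C₀ ^ 2 * (y * t) := h2
      _ = C₀ ^ 2 * t * y := by ring
  exact le_of_mul_le_mul_right h3 hypos

/-- **Fibre bound, deep prime in `b`.**  For fixed `a, v, p` there is `N₁` with `p^k ≤ N₁·u` for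
every solution of `a + p^k·u = v·Z⁴` (`0 < a, v, u`, `p` prime): at `x = vZ`,
`x⁴ − v³a = p^k·(v³u)`, so `cellOneLittleO_quartic_sPart` gives `p^k ≤ C·v³·u`.  (Vacuous data
`a = 0`, `v = 0` or `p` not prime get `N₁ = 0`.) [cite: BugeaudEvertseGyory2018, Thm. 2.1 (i)] -/
theorem cellOneLittleO_fibre_left (a v p : ℕ) : ∃ N₁ : ℕ, ∀ k u Z : ℕ, 0 < a → 0 < v → p.Prime →
    0 < u → a + p ^ k * u = v * Z ^ 4 → p ^ k ≤ N₁ * u := by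
  by_cases h : 0 < a ∧ 0 < v ∧ p.Prime
  · obtain ⟨ha, hv, hp⟩ := h
    have hm : ((v : ℤ) ^ 3 * a : ℤ) ≠ 0 := by positivity
    obtain ⟨C, -, hbd⟩ := cellOneLittleO_quartic_sPart hp hm
    refine ⟨⌈C * (v : ℝ) ^ 3⌉₊, ?_⟩
    intro k u Z _ _ _ hu heq
    have heqZ : ((v : ℤ) * (Z : ℤ) ^ 4 : ℤ) = a + (p : ℤ) ^ k * u := by exact_mod_cast heq.symm
    have hx : ((v : ℤ) * Z) ^ 4 - (v : ℤ) ^ 3 * a = (p : ℤ) ^ k * ((v : ℤ) ^ 3 * u) := by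
      linear_combination (v : ℤ) ^ 3 * heqZ
    have hn : ((v : ℤ) ^ 3 * u : ℤ) ≠ 0 := by positivity
    have h1 := hbd _ _ k hn hx
    have h2 : ((p ^ k : ℕ) : ℝ) ≤ ((⌈C * (v : ℝ) ^ 3⌉₊ * u : ℕ) : ℝ) := by
      push_cast at h1 ⊢
      rw [abs_of_nonneg (by positivity)] at h1
      calc (p : ℝ) ^ k ≤ C * ((v : ℝ) ^ 3 * u) := h1
        _ = (C * (v : ℝ) ^ 3) * u := by ring
        _ ≤ ⌈C * (v : ℝ) ^ 3⌉₊ * u := mul_le_mul_of_nonneg_right (Nat.le_ceil _) (Nat.cast_nonneg _)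
    exact_mod_cast h2
  · exact ⟨0, fun k u Z ha hv hp _ _ => absurd ⟨ha, hv, hp⟩ h⟩

/-- **Fibre bound, deep prime in `c`.**  For fixed `a, u, p` there is `N₂` with `p^w ≤ N₂·v` for
every solution of `a + u·Y⁴ = p^w·v` (`0 < a, u, v`, `p` prime): at `x = uY`,
`x⁴ + u³a = p^w·(u³v)`, so `cellOneLittleO_quartic_sPart` (with `m = −u³a`) gives `p^w ≤ C·u³·v`.
[cite: BugeaudEvertseGyory2018, Thm. 2.1 (i)] -/
theorem cellOneLittleO_fibre_right (a u p : ℕ) : ∃ N₂ : ℕ, ∀ w v Y : ℕ, 0 < a → 0 < u → p.Prime →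
    0 < v → a + u * Y ^ 4 = p ^ w * v → p ^ w ≤ N₂ * v := by
  by_cases h : 0 < a ∧ 0 < u ∧ p.Prime
  · obtain ⟨ha, hu, hp⟩ := h
    have hm : (-((u : ℤ) ^ 3 * a) : ℤ) ≠ 0 := neg_ne_zero.mpr (by positivity)
    obtain ⟨C, -, hbd⟩ := cellOneLittleO_quartic_sPart hp hm
    refine ⟨⌈C * (u : ℝ) ^ 3⌉₊, ?_⟩
    intro w v Y _ _ _ hv heq
    have heqZ : ((a : ℤ) + (u : ℤ) * (Y : ℤ) ^ 4 : ℤ) = (p : ℤ) ^ w * v := by exact_mod_cast heq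
    have hx : ((u : ℤ) * Y) ^ 4 - (-((u : ℤ) ^ 3 * a)) = (p : ℤ) ^ w * ((u : ℤ) ^ 3 * v) := by
      linear_combination (u : ℤ) ^ 3 * heqZ
    have hn : ((u : ℤ) ^ 3 * v : ℤ) ≠ 0 := by positivity
    have h1 := hbd _ _ w hn hx
    have h2 : ((p ^ w : ℕ) : ℝ) ≤ ((⌈C * (u : ℝ) ^ 3⌉₊ * v : ℕ) : ℝ) := by
      push_cast at h1 ⊢
      rw [abs_of_nonneg (by positivity)] at h1
      calc (p : ℝ) ^ w ≤ C * ((u : ℝ) ^ 3 * v) := h1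
        _ = (C * (u : ℝ) ^ 3) * v := by ring
        _ ≤ ⌈C * (u : ℝ) ^ 3⌉₊ * v := mul_le_mul_of_nonneg_right (Nat.le_ceil _) (Nat.cast_nonneg _)
    exact_mod_cast h2
  · exact ⟨0, fun w v Y ha hu hp _ _ => absurd ⟨ha, hu, hp⟩ h⟩

/-- **Uniform fibre bound over a box, deep prime in `b`.**  For every `N` there is `M` with
`p^k ≤ M·u` for all solutions of `a + p^k·u = v·Z⁴` (`0 < a, v, u`, `p` prime) with
`a, v, p ≤ N`: the maximum of `cellOneLittleO_fibre_left` over the finite box (pattern of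
`fibreRoth_box`). [cite: BugeaudEvertseGyory2018, Thm. 2.1 (i)] -/
theorem cellOneLittleO_box_left (N : ℕ) : ∃ M : ℕ, ∀ a v p k u Z : ℕ, 0 < a → 0 < v → p.Prime →
    0 < u → a ≤ N → v ≤ N → p ≤ N → a + p ^ k * u = v * Z ^ 4 → p ^ k ≤ M * u := by
  choose g hg using cellOneLittleO_fibre_left
  refine ⟨(Finset.range (N + 1) ×ˢ Finset.range (N + 1) ×ˢ Finset.range (N + 1)).sup
    (fun q => g q.1 q.2.1 q.2.2), ?_⟩
  intro a v p k u Z ha hv hp hu haN hvN hpN heq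
  have hmem : (a, v, p) ∈ Finset.range (N + 1) ×ˢ Finset.range (N + 1) ×ˢ Finset.range (N + 1) := by
    simp only [Finset.mem_product, Finset.mem_range]
    exact ⟨Nat.lt_succ_of_le haN, Nat.lt_succ_of_le hvN, Nat.lt_succ_of_le hpN⟩
  have hgle : g a v p ≤ (Finset.range (N + 1) ×ˢ Finset.range (N + 1) ×ˢ Finset.range (N + 1)).sup
      (fun q => g q.1 q.2.1 q.2.2) :=
    Finset.le_sup (f := fun q : ℕ × ℕ × ℕ => g q.1 q.2.1 q.2.2) hmem
  exact (hg a v p k u Z ha hv hp hu heq).trans (Nat.mul_le_mul_right u hgle)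

/-- **Uniform fibre bound over a box, deep prime in `c`.**  For every `N` there is `M` with
`p^w ≤ M·v` for all solutions of `a + u·Y⁴ = p^w·v` (`0 < a, u, v`, `p` prime) with
`a, u, p ≤ N`: the maximum of `cellOneLittleO_fibre_right` over the finite box.
[cite: BugeaudEvertseGyory2018, Thm. 2.1 (i)] -/
theorem cellOneLittleO_box_right (N : ℕ) : ∃ M : ℕ, ∀ a u p w v Y : ℕ, 0 < a → 0 < u → p.Prime →
    0 < v → a ≤ N → u ≤ N → p ≤ N → a + u * Y ^ 4 = p ^ w * v → p ^ w ≤ M * v := by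
  choose g hg using cellOneLittleO_fibre_right
  refine ⟨(Finset.range (N + 1) ×ˢ Finset.range (N + 1) ×ˢ Finset.range (N + 1)).sup
    (fun q => g q.1 q.2.1 q.2.2), ?_⟩
  intro a u p w v Y ha hu hp hv haN huN hpN heq
  have hmem : (a, u, p) ∈ Finset.range (N + 1) ×ˢ Finset.range (N + 1) ×ˢ Finset.range (N + 1) := by
    simp only [Finset.mem_product, Finset.mem_range]
    exact ⟨Nat.lt_succ_of_le haN, Nat.lt_succ_of_le huN, Nat.lt_succ_of_le hpN⟩
  have hgle : g a u p ≤ (Finset.range (N + 1) ×ˢ Finset.range (N + 1) ×ˢ Finset.range (N + 1)).sup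
      (fun q => g q.1 q.2.1 q.2.2) :=
    Finset.le_sup (f := fun q : ℕ × ℕ × ℕ => g q.1 q.2.1 q.2.2) hmem
  exact (hg a u p w v Y ha hu hp hv heq).trans (Nat.mul_le_mul_right v hgle)

open Literature.NumberTheory.DiophantineGeometry (IsABCTriple rad rad_def) in
/-- **Stub `stub_cellOneLittleO` of line `Sketch`, crux `DepthCountedABC` (stmt-ABC-14938):**
`c = o(rad(abc)⁴)` on the cell `ω₅ ≤ 1`.  For every `κ > 0` there is `c₀` such that every abc triple
with `#{p : v_p(abc) ≥ 5} ≤ 1` and `c ≥ c₀` satisfies `c < κ·rad(abc)⁴` (Ridout's theorem through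
the Bugeaud–Evertse–Győry `S`-part bound, uniform over the finite box of binomial quartic Thue–Mahler
data `a·u·v·p ≤ 16/κ⁴` supplied by `stub_cellOneCases`; ineffective).
[cite: BugeaudEvertseGyory2018, Thm. 2.1 (i)] -/
theorem stub_cellOneLittleO : ∀ κ : ℝ, 0 < κ → ∃ c₀ : ℕ, ∀ a b c : ℕ,
    Literature.NumberTheory.DiophantineGeometry.IsABCTriple a b c →
    ((a * b * c).primeFactors.filter (fun p => 5 ≤ (a * b * c).factorization p)).card ≤ 1 →
    c₀ ≤ c → (c : ℝ) < κ * ((Literature.NumberTheory.DiophantineGeometry.rad a b c : ℕ) : ℝ) ^ 4 := by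
  intro κ hκ
  -- the box size, the two uniform fibre constants over the box, and the threshold
  obtain ⟨N, hN⟩ : ∃ N : ℕ, 16 / κ ^ 4 ≤ (N : ℝ) := exists_nat_ge _
  obtain ⟨M₁, hM₁⟩ := cellOneLittleO_box_left N
  obtain ⟨M₂, hM₂⟩ := cellOneLittleO_box_right N
  obtain ⟨c₁, hc₁⟩ : ∃ c₁ : ℕ, 4 / κ < (c₁ : ℝ) := exists_nat_gt _
  refine ⟨c₁ + N + M₁ * N * N + M₂ * N * N + 1, ?_⟩
  intro a b c habc hK hc₀c
  -- WLOG `a ≤ b` (all data are symmetric in `a, b`)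
  wlog hab : a ≤ b generalizing a b with Hsymm
  · have hsw : IsABCTriple b a c :=
      ⟨habc.2.1, habc.1, by rw [add_comm]; exact habc.2.2.1, habc.2.2.2.symm⟩
    have hprod : b * a * c = a * b * c := by ring
    have hK' : ((b * a * c).primeFactors.filter (fun p => 5 ≤ (b * a * c).factorization p)).card ≤ 1 := by
      rw [hprod]; exact hK
    have := Hsymm b a hsw hK' (le_of_not_ge hab)
    rwa [rad_def, hprod, ← rad_def] at this
  have hcases := stub_cellOneCases a b c habc hab hK
  obtain ⟨ha, hb, hsum, -⟩ := habc
  set R := rad a b c with hR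
  by_contra! hexc
  -- `hexc : κ·R⁴ ≤ c`
  have hcpos : (0 : ℝ) < (c : ℝ) := by exact_mod_cast (show 0 < c by omega)
  have hR4 : (R : ℝ) ^ 4 ≤ (c : ℝ) / κ := by
    rw [le_div_iff₀ hκ, mul_comm]; exact hexc
  have hR16 : (R : ℝ) ^ 16 ≤ ((c : ℝ) / κ) ^ 4 :=
    calc (R : ℝ) ^ 16 = ((R : ℝ) ^ 4) ^ 4 := by ring
      _ ≤ ((c : ℝ) / κ) ^ 4 := pow_le_pow_left₀ (by positivity) hR4 4
  have hc₁c : c₁ ≤ c := le_trans (by omega) hc₀c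
  have hc₁cR : (c₁ : ℝ) ≤ (c : ℝ) := by exact_mod_cast hc₁c
  rcases hcases with h1 | ⟨p, k, u, v, Z, hp, hu, hv, -, heq, -, hcvZ, hF1, -⟩ |
    ⟨p, w, u, v, Y, hp, hu, hv, -, heq, -, hbuY, hc2b, hF1, -⟩
  · -- Case (i): `c < 2R²`, so `κR² < 2` and `c < 4/κ < c₁ ≤ c`
    have h1R : (c : ℝ) < 2 * (R : ℝ) ^ 2 := by exact_mod_cast h1
    have hκR : κ * (R : ℝ) ^ 2 < 2 := by
      have h : (κ * (R : ℝ) ^ 2) * (R : ℝ) ^ 2 < 2 * (R : ℝ) ^ 2 :=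
        calc (κ * (R : ℝ) ^ 2) * (R : ℝ) ^ 2 = κ * (R : ℝ) ^ 4 := by ring
          _ ≤ (c : ℝ) := hexc
          _ < 2 * (R : ℝ) ^ 2 := h1R
      exact lt_of_mul_lt_mul_right h (by positivity)
    have hc4 : (c : ℝ) < 4 / κ := by
      rw [lt_div_iff₀ hκ]
      have : (c : ℝ) * κ < 2 * (R : ℝ) ^ 2 * κ := mul_lt_mul_of_pos_right h1R hκ
      linarith
    linarith
  · -- Case (ii): `a + p^k·u = v·Z⁴ = c`, `a·u·v·p·c⁴ ≤ R¹⁶ ≤ (c/κ)⁴`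
    have hF1R : ((a * u * v * p : ℕ) : ℝ) * (c : ℝ) ^ 4 ≤ (R : ℝ) ^ 16 := by exact_mod_cast hF1
    have hauvpR : ((a * u * v * p : ℕ) : ℝ) ≤ 16 / κ ^ 4 := by
      have h : ((a * u * v * p : ℕ) : ℝ) * (c : ℝ) ^ 4 ≤ (16 / κ ^ 4) * (c : ℝ) ^ 4 :=
        calc ((a * u * v * p : ℕ) : ℝ) * (c : ℝ) ^ 4 ≤ (R : ℝ) ^ 16 := hF1R
          _ ≤ ((c : ℝ) / κ) ^ 4 := hR16
          _ = (1 / κ ^ 4) * (c : ℝ) ^ 4 := by rw [div_pow]; ring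
          _ ≤ (16 / κ ^ 4) * (c : ℝ) ^ 4 := by gcongr; norm_num
      exact le_of_mul_le_mul_right h (by positivity)
    have hauvp : a * u * v * p ≤ N := by exact_mod_cast hauvpR.trans hN
    have haN : a ≤ N :=
      (((Nat.le_mul_of_pos_right a hu).trans (Nat.le_mul_of_pos_right _ hv)).trans
        (Nat.le_mul_of_pos_right _ hp.pos)).trans hauvp
    have huN : u ≤ N :=
      (((Nat.le_mul_of_pos_left u ha).trans (Nat.le_mul_of_pos_right _ hv)).trans
        (Nat.le_mul_of_pos_right _ hp.pos)).trans hauvp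
    have hvN : v ≤ N :=
      ((Nat.le_mul_of_pos_left v (Nat.mul_pos ha hu)).trans (Nat.le_mul_of_pos_right _ hp.pos)).trans hauvp
    have hpN : p ≤ N := (Nat.le_mul_of_pos_left p (Nat.mul_pos (Nat.mul_pos ha hu) hv)).trans hauvp
    have hpk : p ^ k ≤ M₁ * u := hM₁ a v p k u Z ha hv hp hu haN hvN hpN heq
    have hpku : p ^ k * u ≤ M₁ * N * N :=
      (Nat.mul_le_mul_right u hpk).trans (Nat.mul_le_mul (Nat.mul_le_mul_left M₁ huN) huN)
    have hceq : c = a + p ^ k * u := by omega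
    have hcle : c ≤ N + M₁ * N * N := by rw [hceq]; exact Nat.add_le_add haN hpku
    omega
  · -- Case (iii): `a + u·Y⁴ = p^w·v = c`, `c ≤ 2b`, `a·u·v·p·b⁴ ≤ R¹⁶ ≤ (2b/κ)⁴`
    have hbpos : (0 : ℝ) < (b : ℝ) := by exact_mod_cast hb
    have hcb : (c : ℝ) ≤ 2 * (b : ℝ) := by exact_mod_cast hc2b
    have hF1R : ((a * u * v * p : ℕ) : ℝ) * (b : ℝ) ^ 4 ≤ (R : ℝ) ^ 16 := by exact_mod_cast hF1
    have hauvpR : ((a * u * v * p : ℕ) : ℝ) ≤ 16 / κ ^ 4 := by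
      have h : ((a * u * v * p : ℕ) : ℝ) * (b : ℝ) ^ 4 ≤ (16 / κ ^ 4) * (b : ℝ) ^ 4 :=
        calc ((a * u * v * p : ℕ) : ℝ) * (b : ℝ) ^ 4 ≤ (R : ℝ) ^ 16 := hF1R
          _ ≤ ((c : ℝ) / κ) ^ 4 := hR16
          _ ≤ (2 * (b : ℝ) / κ) ^ 4 :=
              pow_le_pow_left₀ (by positivity) (div_le_div_of_nonneg_right hcb hκ.le) 4
          _ = (16 / κ ^ 4) * (b : ℝ) ^ 4 := by rw [div_pow, mul_pow]; ring
      exact le_of_mul_le_mul_right h (by positivity)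
    have hauvp : a * u * v * p ≤ N := by exact_mod_cast hauvpR.trans hN
    have haN : a ≤ N :=
      (((Nat.le_mul_of_pos_right a hu).trans (Nat.le_mul_of_pos_right _ hv)).trans
        (Nat.le_mul_of_pos_right _ hp.pos)).trans hauvp
    have huN : u ≤ N :=
      (((Nat.le_mul_of_pos_left u ha).trans (Nat.le_mul_of_pos_right _ hv)).trans
        (Nat.le_mul_of_pos_right _ hp.pos)).trans hauvp
    have hvN : v ≤ N :=
      ((Nat.le_mul_of_pos_left v (Nat.mul_pos ha hu)).trans (Nat.le_mul_of_pos_right _ hp.pos)).trans hauvp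
    have hpN : p ≤ N := (Nat.le_mul_of_pos_left p (Nat.mul_pos (Nat.mul_pos ha hu) hv)).trans hauvp
    have hpw : p ^ w ≤ M₂ * v := hM₂ a u p w v Y ha hu hp hv haN huN hpN heq
    have hpwv : p ^ w * v ≤ M₂ * N * N :=
      (Nat.mul_le_mul_right v hpw).trans (Nat.mul_le_mul (Nat.mul_le_mul_left M₂ hvN) hvN)
    have hceq : c = p ^ w * v := by rw [← heq, ← hbuY, hsum]
    have hcle : c ≤ M₂ * N * N := hceq ▸ hpwv
    omega

end Summit.ABC.ABC.Theorems.DepthCountedABC
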